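import Literature.Geometry.Kaehler.ComplexTorusKaehlerLieAlgebraComplexification
import Literature.Algebra.Lie.SpecialLinearJordanLefschetzPair
import Literature.Algebra.Lie.LefschetzTripleTransport
import HarnessLib

/-!
# Looijenga–Lunts (2.9) Case `(A_{2m-1}, A_{m-1}+A_{m-1})` BASIS-FREE — `(𝔰𝔩(W), h)` is a Jordan–Lefschetz pair — and (3.4) complexified: `(ℂ ⊗_ℝ 𝔤_K(X; ℝ), 1 ⊗ h)` is a Jordan–Lefschetz pair for a complex torus `X`

Topic `Literature/Geometry/Kaehler` (namespaces `Literature.Geometry.Kaehler.JordanLefschetz` and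
`Literature.Geometry.Kaehler.ComplexTorus`, continued).  Lane `lit-hodgefound` (Track 2 foundations library),
skeleton seat `lit-hodgefound-skel-1` (generation 52), row **A1-209** of `run/shared/lean/pub/lit-hodgefound/SKELETON.md`.

The tree has (i) row A1-191: the split MATRIX pair `(𝔰𝔩(m ⊕ m, K), indefiniteDiagonal)` is a Jordan–Lefschetz pair
(`SpecialLinearJordanLefschetzPair.isJordanLefschetzPair_sl_sum_of_charZero`); (ii) the basis-free `𝔰𝔩(W) = slEnd K W`,
its matrix model `slEndEquivSl b : 𝔰𝔩(W) ≃ₗ⁅K⁆ sl ι K` and, for a splitting `W = W_{-1} ⊕ W_1` (`p = W_{-1}`,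
`q = W_1`, `IsCompl p q`), the grading element `gradingH hpq = π_{W_1} - π_{W_{-1}}` with its graded pieces and
`gradingH_mem_slEnd_iff : h ∈ 𝔰𝔩(W) ↔ dim W_{-1} = dim W_1` (`ComplexTorusKaehlerLieAlgebraComplexification`, §1–§2);
(iii) Looijenga–Lunts (3.4) complexified as a Lie isomorphism `kaehlerLieAlgebraComplexification :
ℂ ⊗_ℝ 𝔤_K(X;ℝ) ≃ₗ⁅ℂ⁆ 𝔰𝔩_ℂ(V ⊕ V̄^*)` carrying `1 ⊗ h` (the counting operator `h = countingG`) to `gradingH` for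
`V ⊕ V̄^* = V_{-1} ⊕ V_1` (`leftSub`, `rightSub`, both of dimension `n`); (iv) row A1-87: Jordan–Lefschetz pairs are
transported along Lie isomorphisms (`IsJordanLefschetzPair.map`).  This file draws the two conclusions that were
not yet stated in the tree:

* §1 **Case `(A_{2m-1}, A_{m-1}+A_{m-1})` BASIS-FREE**: for `dim W_{-1} = dim W_1 = m ≥ 1` over a field of
  characteristic `0`, `(𝔰𝔩(W), h)` is a Jordan–Lefschetz pair (`Literature.Algebra.Lie.IsJordanLefschetzPair`, row
  A1-84) — the matrix of `h` in an adapted basis is `indefiniteDiagonal` (`toMatrix_gradingH`), so `slEndEquivSl`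
  carries `(𝔰𝔩(W), h)` to row A1-191's pair;
* §2 **(3.4) for a complex torus `X = V/Λ` of dimension `n ≥ 1`**: `(𝔰𝔩_ℂ(V ⊕ V̄^*), h)` is a Jordan–Lefschetz pair
  (`isJordanLefschetzPair_slEnd_VVbar`) and hence **`(ℂ ⊗_ℝ 𝔤_K(X; ℝ), 1 ⊗ h)` is a Jordan–Lefschetz pair**
  (`isJordanLefschetzPair_baseChange_kaehlerLieAlgebra`) — the complexified form of "In fact, `(𝔰𝔲(V ⊕ V̄^*), u)` is
  a Jordan–Lefschetz pair.  It is a real form of case `(A_{2n-1}, A_{n-1}+A_{n-1})`."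

THEOREMS ONLY (no definition, no named fact, no `sorry`; net debt `0`).

## Source, VERBATIM

E. Looijenga, V. A. Lunts, *A Lie algebra attached to a projective variety*, Invent. Math. **129** (1997) 361–412 (held
TeX `paper:arxiv-alg-geom_9604014`), (2.9) p. 10 L83–L90: "Case `(A_{2m-1}, A_{m-1}+A_{m-1})`:
`(𝔰𝔩(2m), 𝔰𝔩(m) × 𝔰𝔩(m))`.  Let `V` be a vector space of dimension `2m`, `V = V_{-1} ⊕ V_1` a direct sum decomposition
into subspaces of dimension `m`.  We take `𝔤 := 𝔰𝔩(V)` and let `h ∈ 𝔰𝔩(V)` be `±1` on `V_{±1}`."; (2.6) p. 10 L16–L31: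
"`(A_{2m-1}, A_{m-1}+A_{m-1})` (`m ≥ 1`) … Conversely, every item of this list determines an isomorphism class of
Jordan–Lefschetz pairs."; §3 p. 13 L117–L127: "We now assume that `X` comes with a complex structure.  We shall
determine its Kähler Lie algebra. … Let `𝔰𝔲(V ⊕ V^*)` be the Lie algebra of the corresponding special unitary group.
Since `u ∈ 𝔰𝔲(V ⊕ V̄^*)`, it inherits a grading with degrees `-2`, `0` and `2`.  In fact, `(𝔰𝔲(V ⊕ V̄^*), u)` is a
Jordan–Lefschetz pair.  It is a real form of case `(A_{2n-1}, A_{n-1}+A_{n-1})`."; (3.4) Proposition, p. 14 L1–L3: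
"There is a natural identification `(𝔤_K(X; ℝ), h) ≅ (𝔰𝔲(V ⊕ V̄^*), u)`; this is a real form of the case
`(A_{2n-1}, A_{n-1}+A_{n-1})`."

## Contents (all proved)

* §1 `toMatrix_gradingH` (`Mat_b(h) = indefiniteDiagonal` in the basis `b = (b_{W_1}, b_{W_{-1}})`),
  **`isJordanLefschetzPair_slEnd_gradingH`**, `isLefschetzPair_slEnd_gradingH`;
* §2 **`isJordanLefschetzPair_slEnd_VVbar`**, **`isJordanLefschetzPair_baseChange_kaehlerLieAlgebra`**,
  `isLefschetzPair_baseChange_kaehlerLieAlgebra`.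

## SCOPE (what is NOT formalised here)

The REAL statement "`(𝔰𝔲(V ⊕ V̄^*), u)` — equivalently `(𝔤_K(X; ℝ), h)` — is a Jordan–Lefschetz pair over `ℝ`" (a
real form) is not proved here: only its complexification.  The fundamental-module clause of (3.4)
(`⊕_k H^{k,k}(X)[n]`) is row A1-45's business (`ComplexTorusJordanLefschetzModules`).  TODO(layering): §1 and the
`slEnd`/`gradingH` material it uses are pure linear algebra and could move to `Literature/Algebra/Lie`.

## References

* [LooijengaLunts1997] E. Looijenga, V. A. Lunts, *A Lie algebra attached to a projective variety*, Invent. Math. 129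
  (1997) 361–412; arXiv:alg-geom/9604014. §2 (2.6), (2.9) p. 10; §3 p. 13, (3.4) p. 14 (held
  `paper:arxiv-alg-geom_9604014`).
-/

namespace Literature.Geometry.Kaehler

namespace JordanLefschetz

open Module LieAlgebra LieAlgebra.Orthogonal Matrix Sum Function Literature.Algebra.Lie

variable {K W : Type*} [Field K] [AddCommGroup W] [Module K W] {p q : Submodule K W}

/-! ### §1 Case `(A_{2m-1}, A_{m-1}+A_{m-1})` basis-free: `(𝔰𝔩(W), h)` for `W = W_{-1} ⊕ W_1`, `dim W_{-1} = dim W_1 ≥ 1` -/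

/-- The matrix of `h = π_{W_1} - π_{W_{-1}}` in a basis adapted to `W = W_1 ⊕ W_{-1}` (first the basis of `W_1`, then
that of `W_{-1}`) is `diag(1, …, 1, -1, …, -1) = indefiniteDiagonal`. [cite: LooijengaLunts1997, §2 (2.9) p. 10 L83–L87 ("h ∈ 𝔰𝔩(V) be ±1 on V_{±1}")] -/
theorem toMatrix_gradingH (hpq : IsCompl p q) {ι : Type*} [Fintype ι] [DecidableEq ι] (bp : Basis ι K p)
    (bq : Basis ι K q) :
    LinearMap.toMatrix ((bq.prod bp).map (Submodule.prodEquivOfIsCompl q p hpq.symm))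
        ((bq.prod bp).map (Submodule.prodEquivOfIsCompl q p hpq.symm)) (gradingH hpq) =
      indefiniteDiagonal ι ι K := by
  set b := (bq.prod bp).map (Submodule.prodEquivOfIsCompl q p hpq.symm) with hb
  have hbl : ∀ i, b (inl i) = (bq i : W) := fun i ↦ by
    rw [hb, Basis.map_apply, Submodule.coe_prodEquivOfIsCompl', Basis.prod_apply_inl_fst, Basis.prod_apply_inl_snd,
      ZeroMemClass.coe_zero, add_zero]
  have hbr : ∀ i, b (inr i) = (bp i : W) := fun i ↦ by
    rw [hb, Basis.map_apply, Submodule.coe_prodEquivOfIsCompl', Basis.prod_apply_inr_fst, Basis.prod_apply_inr_snd,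
      ZeroMemClass.coe_zero, zero_add]
  ext i j
  rw [LinearMap.toMatrix_apply, indefiniteDiagonal, Matrix.diagonal_apply]
  rcases j with j | j
  · rw [hbl, gradingH_apply_of_mem_right hpq (bq j).2, ← hbl, b.repr_self, Finsupp.single_apply]
    rcases i with i | i <;> simp [eq_comm]
  · rw [hbr, gradingH_apply_of_mem_left hpq (bp j).2, map_neg, ← hbr, b.repr_self, Finsupp.neg_apply,
      Finsupp.single_apply]
    rcases i with i | i
    · simp
    · simp only [Sum.inr.injEq, Sum.elim_inr]
      split_ifs with h1 h2 h2
      · rfl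
      · exact absurd h1.symm h2
      · exact absurd h2.symm h1
      · rw [neg_zero]

variable [CharZero K] [FiniteDimensional K W]

/-- **(2.6)/(2.9) Case `(A_{2m-1}, A_{m-1}+A_{m-1})`, BASIS-FREE: for a splitting `W = W_{-1} ⊕ W_1` into subspaces of
the same dimension `m ≥ 1`, `(𝔰𝔩(W), h)` with "`h ∈ 𝔰𝔩(V)` … `±1` on `V_{±1}`" is a Jordan–Lefschetz pair** — row A1-191's
matrix pair `(𝔰𝔩(m ⊕ m, K), indefiniteDiagonal)` transported along `slEndEquivSl` in an adapted basis (row A1-87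
`IsJordanLefschetzPair.map`). [cite: LooijengaLunts1997, §2 (2.6) p. 10 L16–L31 ("(A_{2m-1}, A_{m-1}+A_{m-1}) (m ≥ 1) … every item of this list determines an isomorphism class of Jordan–Lefschetz pairs"), (2.9) p. 10 L83–L90] -/
theorem isJordanLefschetzPair_slEnd_gradingH (hpq : IsCompl p q) (hdim : finrank K p = finrank K q)
    (hq : finrank K q ≠ 0) :
    IsJordanLefschetzPair K (⟨gradingH hpq, (gradingH_mem_slEnd_iff hpq).2 hdim⟩ : slEnd K W) := by
  haveI : Nonempty (Fin (finrank K q)) := ⟨⟨0, Nat.pos_of_ne_zero hq⟩⟩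
  let bq : Basis (Fin (finrank K q)) K q := finBasisOfFinrankEq K q rfl
  let bp : Basis (Fin (finrank K q)) K p := finBasisOfFinrankEq K p hdim
  let b := (bq.prod bp).map (Submodule.prodEquivOfIsCompl q p hpq.symm)
  let e := slEndEquivSl b
  have he : e ⟨gradingH hpq, (gradingH_mem_slEnd_iff hpq).2 hdim⟩ =
      ⟨indefiniteDiagonal _ _ K, SpecialLinearJordanLefschetzPair.indefiniteDiagonal_mem_sl⟩ := by
    apply Subtype.ext
    rw [slEndEquivSl_apply]
    exact toMatrix_gradingH hpq bp bq
  have J := (SpecialLinearJordanLefschetzPair.isJordanLefschetzPair_sl_sum_of_charZero (K := K)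
    (m := Fin (finrank K q))).map e.symm
  rwa [← he, LieEquiv.symm_apply_apply] at J

/-- Hence `(𝔰𝔩(W), h)` is a Lefschetz pair. [cite: LooijengaLunts1997, §1 p. 7 L77–L78, §2 (2.9) p. 10 L83–L90] -/
theorem isLefschetzPair_slEnd_gradingH (hpq : IsCompl p q) (hdim : finrank K p = finrank K q) (hq : finrank K q ≠ 0) :
    IsLefschetzPair K (⟨gradingH hpq, (gradingH_mem_slEnd_iff hpq).2 hdim⟩ : slEnd K W) :=
  (isJordanLefschetzPair_slEnd_gradingH hpq hdim hq).isLefschetzPair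

end JordanLefschetz

/-! ### §2 The complex torus: `(ℂ ⊗_ℝ 𝔤_K(X;ℝ), h)` is a Jordan–Lefschetz pair of type `(A_{2n-1}, A_{n-1}+A_{n-1})` -/

namespace ComplexTorus

open Module Literature.Algebra.Lie TensorProduct Literature.LinearAlgebra.Alternating

variable (E : Type*) [NormedAddCommGroup E] [NormedSpace ℂ E] [FiniteDimensional ℂ E]

/-- **`(𝔰𝔩_ℂ(V ⊕ V̄^*), h)` is a Jordan–Lefschetz pair** for a complex torus `X = V/Λ` of dimension `n ≥ 1`
(`V_{-1} = V`, `V_1 = V̄^*`, both of dimension `n`). [cite: LooijengaLunts1997, §3 (3.4) p. 14 L1–L3 ("a real form of the case (A_{2n-1}, A_{n-1}+A_{n-1})"), p. 13 L125–L127] -/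
theorem isJordanLefschetzPair_slEnd_VVbar [Nontrivial E] :
    IsJordanLefschetzPair ℂ (⟨JordanLefschetz.gradingH (isCompl_leftSub_rightSub E), gradingH_mem_slEnd E⟩ :
      JordanLefschetz.slEnd ℂ (VVbar E)) := by
  have hdim : finrank ℂ (leftSub E) = finrank ℂ (rightSub E) := by rw [finrank_leftSub, finrank_rightSub]
  have hq : finrank ℂ (rightSub E) ≠ 0 := by rw [finrank_rightSub]; exact finrank_pos.ne'
  exact JordanLefschetz.isJordanLefschetzPair_slEnd_gradingH (isCompl_leftSub_rightSub E) hdim hq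

/-- **Looijenga–Lunts (3.4), the Jordan–Lefschetz clause, complexified: `(ℂ ⊗_ℝ 𝔤_K(X; ℝ), 1 ⊗ h)` is a
Jordan–Lefschetz pair** — `h` the counting operator of `H•(X, ℂ)`; through
`kaehlerLieAlgebraComplexification : ℂ ⊗_ℝ 𝔤_K(X;ℝ) ≅ 𝔰𝔩_ℂ(V ⊕ V̄^*)`, `1 ⊗ h ↦ gradingH`.  ("In fact,
`(𝔰𝔲(V ⊕ V̄^*), u)` is a Jordan–Lefschetz pair.  It is a real form of case `(A_{2n-1}, A_{n-1}+A_{n-1})`"; the real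
statement is not claimed here.) [cite: LooijengaLunts1997, §3 p. 13 L123–L127, (3.4) p. 14 L1–L3] -/
theorem isJordanLefschetzPair_baseChange_kaehlerLieAlgebra [Nontrivial E] :
    IsJordanLefschetzPair ℂ
      ((1 : ℂ) ⊗ₜ[ℝ] (⟨countingG E, countingG_mem_kaehlerLieAlgebra' E⟩ : kaehlerLieAlgebra E) :
        ℂ ⊗[ℝ] kaehlerLieAlgebra E) := by
  have hu : kaehlerLieAlgebraEquiv E ⟨⟨gradingElement E, gradingElement_mem_so E⟩, gradingElement_mem_su E⟩ =
      (⟨countingG E, countingG_mem_kaehlerLieAlgebra' E⟩ : kaehlerLieAlgebra E) :=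
    Subtype.ext (kaehlerLieAlgebraEquiv_gradingElement (E := E))
  have h1 : kaehlerLieAlgebraComplexification E
      ((1 : ℂ) ⊗ₜ[ℝ] (⟨countingG E, countingG_mem_kaehlerLieAlgebra' E⟩ : kaehlerLieAlgebra E)) =
      ⟨JordanLefschetz.gradingH (isCompl_leftSub_rightSub E), gradingH_mem_slEnd E⟩ := by
    apply Subtype.ext
    rw [← hu]
    exact kaehlerLieAlgebraComplexification_gradingElement E
  have J := (isJordanLefschetzPair_slEnd_VVbar E).map (kaehlerLieAlgebraComplexification E).symm
  rwa [← h1, LieEquiv.symm_apply_apply] at J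

/-- Hence `(ℂ ⊗_ℝ 𝔤_K(X; ℝ), 1 ⊗ h)` is a Lefschetz pair. [cite: LooijengaLunts1997, §3 (3.4) p. 14 L1–L3] -/
theorem isLefschetzPair_baseChange_kaehlerLieAlgebra [Nontrivial E] :
    IsLefschetzPair ℂ
      ((1 : ℂ) ⊗ₜ[ℝ] (⟨countingG E, countingG_mem_kaehlerLieAlgebra' E⟩ : kaehlerLieAlgebra E) :
        ℂ ⊗[ℝ] kaehlerLieAlgebra E) :=
  (isJordanLefschetzPair_baseChange_kaehlerLieAlgebra E).isLefschetzPair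

end ComplexTorus

end Literature.Geometry.Kaehler
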